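import Summits.RiemannHypothesis.RiemannHypothesis.Theorems.OddSectorOddBartaFloorDefs
import Literature.NumberTheory.LFunctions.WeilThetaPhiMellin
import Literature.NumberTheory.LFunctions.WeilWindowSuzukiProofs
import HarnessLib

/-!
# The window image of the odd theta vector is square-integrable on the window
(crux OddBartaFloor, line Sketch, stub imageMemLp)

For `a > 0` the window image `T_a = 2ϖ_a sinh(t/2) + P_a + A_a` (`oddThetaImage a` of
`OddSectorOddBartaFloorDefs.lean`) satisfies `𝟙_{(−a,a)} T_a ∈ L²(ℝ)`.

* The polar part is continuous, hence bounded on the window.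
* The prime layer `P_a(t) = Σ_n Λ(n) n^{-1/2} (R_a(t − log n) + R_a(t + log n))` is bounded on
  `|t| ≤ b` for every `b`, and measurable: `|R_a| ≤ |Φ′| ≤ 5088 e^{|x|/2 − (π/2)e^{2|x|}}`
  (`abs_weilThetaPhiDeriv_le`) and `log n − b ≤ |t ± log n| ≤ log n + b` give the summable majorant
  `10176 e^{b} n² e^{−(π/2)e^{−2b} n}`; measurability follows from the pointwise convergence of the
  measurable partial sums.
* The archimedean layer `A_a(t) = ∫ R_a(s) w(|t − s|) ds` is measurable (measurability of a
  parametric Bochner integral with jointly measurable integrand) and, on the window,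
  `|A_a(t)| ≤ K₁ (a − t)^{−1/4} + K₂ (a + t)^{−1/4}`: by `w(r) ≤ e^{r/2}/(2r)`
  (`weilArchDensity_le_exp_half_div`) and the weighted AM–GM inequality
  `(s − a)^{3/4} (a − t)^{1/4} ≤ s − t`, the integrand is dominated by
  `2544 e^{a/2} · e^{−(s−a)} (s − a)^{−3/4} · (a − t)^{−1/4}`, a translate of Euler's `Γ(1/4)`
  integrand (`Real.GammaIntegral_convergent`); finally `(a ∓ t)^{−1/4} ∈ L²(−a, a)`.

Sources: 2001 programme, route `odd-sector-eigenfunction-sign`, results §3 (internal, unpublished);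
E. Bombieri, *Remarks on Weil's quadratic functional in the theory of prime numbers* I, Rend. Lincei
(9) 11 (2000), Thm. 2 (the archimedean density `w`). Everything proved here is folklore real analysis.
-/

set_option linter.dupNamespace false

noncomputable section

open Set MeasureTheory Filter Complex
open scoped Real Topology ComplexConjugate ArithmeticFunction.vonMangoldt ENNReal

namespace Summit.RiemannHypothesis.RiemannHypothesis.Theorems.OddBartaFloor

open Literature.NumberTheory.LFunctions

/-! ## The odd tail `R_a` -/

/-- `|R_a(x)| ≤ |Φ′(x)|`. [folklore] -/
private theorem abs_oddThetaTail_le (a x : ℝ) : |oddThetaTail a x| ≤ |weilThetaPhiDeriv x| := by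
  rw [oddThetaTail_def]
  by_cases hx : x ∈ Icc (-a) a
  · rw [weilOddThetaVector_of_mem hx, sub_neg_eq_add, neg_add_cancel, abs_zero]
    exact abs_nonneg _
  · rw [weilOddThetaVector_of_not_mem hx, sub_zero, abs_neg]

/-- `R_a` is measurable. [folklore] -/
private theorem measurable_oddThetaTail (a : ℝ) : Measurable (oddThetaTail a) :=
  continuous_weilThetaPhiDeriv.measurable.neg.sub (measurable_weilOddThetaVector a)

/-- Off the closed window, `R_a = −Φ′`. [folklore] -/
private theorem oddThetaTail_of_not_mem {a s : ℝ} (hs : s ∉ Icc (-a) a) :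
    oddThetaTail a s = -weilThetaPhiDeriv s := by
  rw [oddThetaTail_def, weilOddThetaVector_of_not_mem hs, sub_zero]

/-- On the closed window, `R_a = 0`. [folklore] -/
private theorem oddThetaTail_of_mem {a s : ℝ} (hs : s ∈ Icc (-a) a) : oddThetaTail a s = 0 := by
  rw [oddThetaTail_def, weilOddThetaVector_of_mem hs, sub_neg_eq_add, neg_add_cancel]

/-! ## The prime layer: a summable majorant, uniform on `|t| ≤ b` -/

/-- Shifted decay of `Φ′`: for `n ≥ 1`, `b ≥ 0` and `log n − b ≤ |x| ≤ log n + b`,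
`|Φ′(x)| ≤ 5088 · n e^{b} e^{−(π/2)e^{−2b} n}`. [folklore] -/
private theorem abs_weilThetaPhiDeriv_shift_le {b x : ℝ} {n : ℕ} (hn : 1 ≤ n) (hb : 0 ≤ b)
    (h1 : Real.log n - b ≤ |x|) (h2 : |x| ≤ Real.log n + b) :
    |weilThetaPhiDeriv x| ≤ 5088 * ((n : ℝ) * rexp b * rexp (-(π / 2 * rexp (-(2 * b))) * n)) := by
  have hn' : (1 : ℝ) ≤ n := by exact_mod_cast hn
  have hL : rexp (Real.log n) = n := Real.exp_log (by linarith)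
  have hL0 : 0 ≤ Real.log n := Real.log_nonneg hn'
  have key : (n : ℝ) * rexp b * rexp (-(π / 2 * rexp (-(2 * b))) * n) =
      rexp (Real.log n + b + -(π / 2 * rexp (-(2 * b))) * n) := by
    rw [Real.exp_add, Real.exp_add, hL]
  rw [key]
  refine (abs_weilThetaPhiDeriv_le x).trans (mul_le_mul_of_nonneg_left (Real.exp_le_exp.2 ?_)
    (by norm_num))
  have h3 : rexp (2 * (Real.log n - b)) ≤ rexp (2 * |x|) := Real.exp_le_exp.2 (by linarith)
  rw [show (2 : ℝ) * (Real.log n - b) = Real.log n + Real.log n + -(2 * b) by ring, Real.exp_add,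
    Real.exp_add, hL] at h3
  have h4 : (1 : ℝ) * (n * rexp (-(2 * b))) ≤ n * (n * rexp (-(2 * b))) :=
    mul_le_mul_of_nonneg_right hn' (by positivity)
  have h5 : π / 2 * (n * rexp (-(2 * b))) ≤ π / 2 * rexp (2 * |x|) :=
    mul_le_mul_of_nonneg_left (by linarith) (by positivity)
  linarith

/-- The `n`-th term of the prime layer is dominated, uniformly on `|t| ≤ b`, by the summable
sequence `10176 e^{b} n² e^{−(π/2)e^{−2b} n}`. [folklore] -/
private theorem abs_primeTerm_le (a : ℝ) {b t : ℝ} (ht : |t| ≤ b) (n : ℕ) :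
    |(Λ n : ℝ) / Real.sqrt n * (oddThetaTail a (t - Real.log n) + oddThetaTail a (t + Real.log n))| ≤
      10176 * rexp b * ((n : ℝ) ^ 2 * rexp (-(π / 2 * rexp (-(2 * b))) * n)) := by
  rcases Nat.eq_zero_or_pos n with rfl | hn
  · simp
  have hn' : (1 : ℝ) ≤ n := by exact_mod_cast hn
  have hb : 0 ≤ b := (abs_nonneg t).trans ht
  have hL0 : 0 ≤ Real.log n := Real.log_nonneg hn'
  obtain ⟨ht1, ht2⟩ := abs_le.1 ht
  have hc0 : 0 ≤ (Λ n : ℝ) / Real.sqrt n :=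
    div_nonneg ArithmeticFunction.vonMangoldt_nonneg (Real.sqrt_nonneg _)
  have hc1 : (Λ n : ℝ) / Real.sqrt n ≤ n :=
    (div_le_self ArithmeticFunction.vonMangoldt_nonneg (Real.one_le_sqrt.2 hn')).trans
      (ArithmeticFunction.vonMangoldt_le_log.trans (Real.log_le_self (by linarith)))
  have h1 := abs_weilThetaPhiDeriv_shift_le (x := t - Real.log n) hn hb
    (by linarith [neg_le_abs (t - Real.log n)])
    ((abs_sub _ _).trans (by rw [abs_of_nonneg hL0]; linarith))
  have h2 := abs_weilThetaPhiDeriv_shift_le (x := t + Real.log n) hn hb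
    (by linarith [le_abs_self (t + Real.log n)])
    ((abs_add_le _ _).trans (by rw [abs_of_nonneg hL0]; linarith))
  rw [abs_mul, abs_of_nonneg hc0]
  calc _ ≤ (n : ℝ) * (5088 * ((n : ℝ) * rexp b * rexp (-(π / 2 * rexp (-(2 * b))) * n)) +
        5088 * ((n : ℝ) * rexp b * rexp (-(π / 2 * rexp (-(2 * b))) * n))) :=
        mul_le_mul hc1 ((abs_add_le _ _).trans (add_le_add ((abs_oddThetaTail_le _ _).trans h1)
          ((abs_oddThetaTail_le _ _).trans h2))) (abs_nonneg _) (Nat.cast_nonneg _)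
    _ = _ := by ring

/-- The majorant is summable. [folklore] -/
private theorem summable_primeMajorant (b : ℝ) :
    Summable fun n : ℕ => 10176 * rexp b * ((n : ℝ) ^ 2 * rexp (-(π / 2 * rexp (-(2 * b))) * n)) :=
  (Real.summable_pow_mul_exp_neg_nat_mul 2 (by positivity)).mul_left _

/-- The prime layer converges absolutely at every `t`. [folklore] -/
private theorem summable_primeTerm (a t : ℝ) : Summable fun n : ℕ =>
    (Λ n : ℝ) / Real.sqrt n * (oddThetaTail a (t - Real.log n) + oddThetaTail a (t + Real.log n)) :=
  (summable_primeMajorant |t|).of_norm_bounded fun n =>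
    (Real.norm_eq_abs _).trans_le (abs_primeTerm_le a le_rfl n)

/-- Uniform bound of the prime layer on `|t| ≤ b`. [folklore] -/
private theorem abs_oddThetaPrimeLayer_le (a : ℝ) {b t : ℝ} (ht : |t| ≤ b) :
    |oddThetaPrimeLayer a t| ≤
      ∑' n : ℕ, 10176 * rexp b * ((n : ℝ) ^ 2 * rexp (-(π / 2 * rexp (-(2 * b))) * n)) := by
  have h := tsum_of_norm_bounded (summable_primeMajorant b).hasSum
    fun n => (Real.norm_eq_abs _).trans_le (abs_primeTerm_le a ht n)
  rwa [Real.norm_eq_abs] at h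

/-- The prime layer is measurable (pointwise limit of its measurable partial sums). [folklore] -/
private theorem measurable_oddThetaPrimeLayer (a : ℝ) : Measurable (oddThetaPrimeLayer a) := by
  have hR := measurable_oddThetaTail a
  refine measurable_of_tendsto_metrizable (f := fun N t => ∑ n ∈ Finset.range N,
    (Λ n : ℝ) / Real.sqrt n * (oddThetaTail a (t - Real.log n) + oddThetaTail a (t + Real.log n)))
    (fun N => Finset.measurable_sum _ fun n _ => by fun_prop) ?_
  exact tendsto_pi_nhds.2 fun t => (summable_primeTerm a t).hasSum.tendsto_sum_nat

/-! ## The archimedean layer -/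

/-- The archimedean layer is measurable. [folklore] -/
private theorem measurable_oddThetaArchLayer (a : ℝ) : Measurable (oddThetaArchLayer a) := by
  have hw : Measurable weilArchDensity := by
    unfold weilArchDensity
    exact (Real.continuous_exp.comp (continuous_id.div_const 2)).measurable.div
      (continuous_const.mul Real.continuous_sinh).measurable
  have hf : Measurable fun p : ℝ × ℝ => oddThetaTail a p.2 * weilArchDensity |p.1 - p.2| :=
    ((measurable_oddThetaTail a).comp measurable_snd).mul
      (hw.comp (continuous_abs.measurable.comp (measurable_fst.sub measurable_snd)))
  exact (hf.stronglyMeasurable.integral_prod_right' (ν := volume)).measurable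

/-- One-sided kernel majorant: for `a < s` and `−a < t < a`,
`|Φ′(s)| w(s − t) ≤ 2544 e^{a/2} · e^{−(s−a)} (s − a)^{−3/4} · (a − t)^{−1/4}` (decay of `Φ′`,
`w(r) ≤ e^{r/2}/(2r)` and the weighted AM–GM inequality). [folklore] -/
private theorem kernel_le {a s t : ℝ} (hs : a < s) (ht1 : -a < t) (ht2 : t < a) :
    |weilThetaPhiDeriv s| * weilArchDensity (s - t) ≤
      2544 * rexp (a / 2) * (rexp (-(s - a)) * (s - a) ^ (1 / 4 - 1 : ℝ)) *
        (a - t) ^ (-(1 / 4) : ℝ) := by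
  have hd : 0 < s - a := sub_pos.2 hs
  have hδ : 0 < a - t := sub_pos.2 ht2
  have hst : 0 < s - t := by linarith
  have hE : rexp (1 / 2 * |s| - π / 2 * rexp (2 * |s|)) * rexp ((s - t) / 2) ≤
      rexp (a / 2) * rexp (-(s - a)) := by
    rw [← Real.exp_add, ← Real.exp_add, abs_of_pos (by linarith : (0 : ℝ) < s)]
    refine Real.exp_le_exp.2 ?_
    have h5 : rexp (2 * s) ≤ π / 2 * rexp (2 * s) :=
      le_mul_of_one_le_left (Real.exp_pos _).le (by linarith [Real.pi_gt_three])
    linarith [Real.add_one_le_exp (2 * s)]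
  have hamgm := Real.geom_mean_le_arith_mean2_weighted (w₁ := 3 / 4) (w₂ := 1 / 4) (by norm_num)
    (by norm_num) hd.le hδ.le (by norm_num)
  have hD : (2 * (s - t))⁻¹ ≤ 2⁻¹ * ((s - a) ^ (1 / 4 - 1 : ℝ) * (a - t) ^ (-(1 / 4) : ℝ)) := by
    rw [show (1 / 4 - 1 : ℝ) = -(3 / 4) by norm_num, Real.rpow_neg hd.le, Real.rpow_neg hδ.le,
      ← mul_inv, ← mul_inv]
    exact inv_anti₀ (by positivity) (by linarith)
  calc |weilThetaPhiDeriv s| * weilArchDensity (s - t)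
      ≤ (5088 * rexp (1 / 2 * |s| - π / 2 * rexp (2 * |s|))) * (rexp ((s - t) / 2) / (2 * (s - t))) :=
        mul_le_mul (abs_weilThetaPhiDeriv_le s) (weilArchDensity_le_exp_half_div hst)
          (weilArchDensity_pos hst).le (by positivity)
    _ = 5088 * (rexp (1 / 2 * |s| - π / 2 * rexp (2 * |s|)) * rexp ((s - t) / 2)) *
          (2 * (s - t))⁻¹ := by
        rw [div_eq_mul_inv]; ring
    _ ≤ 5088 * (rexp (a / 2) * rexp (-(s - a))) *
          (2⁻¹ * ((s - a) ^ (1 / 4 - 1 : ℝ) * (a - t) ^ (-(1 / 4) : ℝ))) := by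
        gcongr 5088 * ?_ * ?_
    _ = _ := by ring

/-- Bound of the archimedean layer on the window:
`|A_a(t)| ≤ K₁ (a − t)^{−1/4} + K₂ (a + t)^{−1/4}` for `t ∈ (−a, a)`. [folklore] -/
private theorem exists_abs_oddThetaArchLayer_le (a : ℝ) : ∃ K₁ K₂ : ℝ,
    ∀ t ∈ Ioo (-a) a, |oddThetaArchLayer a t| ≤
      K₁ * (a - t) ^ (-(1 / 4) : ℝ) + K₂ * (a + t) ^ (-(1 / 4) : ℝ) := by
  set b0 : ℝ → ℝ := (Ioi (0 : ℝ)).indicator fun x => rexp (-x) * x ^ (1 / 4 - 1 : ℝ) with hb0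
  have hint : Integrable b0 :=
    (integrable_indicator_iff measurableSet_Ioi).2 (Real.GammaIntegral_convergent (by norm_num))
  have hI1 : Integrable fun s => b0 (s - a) := hint.comp_sub_right a
  have hI2 : Integrable fun s => b0 (-s - a) := hI1.comp_neg
  have hnn : ∀ x, 0 ≤ b0 x := fun x =>
    Set.indicator_nonneg (fun y (hy : y ∈ Ioi (0 : ℝ)) => by
      have : (0 : ℝ) < y := hy
      positivity) x
  have hpos : ∀ x, 0 < x → b0 x = rexp (-x) * x ^ (1 / 4 - 1 : ℝ) := fun x hx =>
    indicator_of_mem (mem_Ioi.2 hx) _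
  refine ⟨2544 * rexp (a / 2) * ∫ s, b0 (s - a), 2544 * rexp (a / 2) * ∫ s, b0 (-s - a),
    fun t ht => ?_⟩
  have hδ1 : 0 < a - t := by linarith [ht.2]
  have hδ2 : 0 < a + t := by linarith [ht.1]
  have key : ∀ s, ‖oddThetaTail a s * weilArchDensity |t - s|‖ ≤ 2544 * rexp (a / 2) *
      (b0 (s - a) * (a - t) ^ (-(1 / 4) : ℝ) + b0 (-s - a) * (a + t) ^ (-(1 / 4) : ℝ)) := by
    intro s
    rw [Real.norm_eq_abs]
    rcases lt_or_ge a s with hs | hs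
    · have hw : 0 < weilArchDensity |t - s| := weilArchDensity_pos (abs_pos.2 (by linarith))
      rw [oddThetaTail_of_not_mem (fun h => by linarith [h.2]), abs_mul, abs_neg, abs_of_pos hw,
        abs_sub_comm, abs_of_pos (by linarith : (0 : ℝ) < s - t), hpos _ (sub_pos.2 hs)]
      have := kernel_le hs ht.1 ht.2
      have h0 : 0 ≤ 2544 * rexp (a / 2) * (b0 (-s - a) * (a + t) ^ (-(1 / 4) : ℝ)) := by
        have := hnn (-s - a); positivity
      linarith
    rcases lt_or_ge s (-a) with hs' | hs'
    · have hw : 0 < weilArchDensity |t - s| := weilArchDensity_pos (abs_pos.2 (by linarith))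
      have := kernel_le (a := a) (s := -s) (t := -t) (by linarith) (by linarith [ht.2])
        (by linarith [ht.1])
      rw [weilThetaPhiDeriv_neg, abs_neg, sub_neg_eq_add, sub_neg_eq_add] at this
      rw [oddThetaTail_of_not_mem (fun h => by linarith [h.1]), abs_mul, abs_neg, abs_of_pos hw,
        abs_of_pos (by linarith : (0 : ℝ) < t - s), hpos _ (by linarith : (0 : ℝ) < -s - a),
        show t - s = -s + t by ring]
      have h0 : 0 ≤ 2544 * rexp (a / 2) * (b0 (s - a) * (a - t) ^ (-(1 / 4) : ℝ)) := by
        have := hnn (s - a); positivity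
      linarith
    · rw [oddThetaTail_of_mem ⟨hs', hs⟩, zero_mul, abs_zero]
      have := hnn (s - a); have := hnn (-s - a); positivity
  have hmaj : Integrable fun s => 2544 * rexp (a / 2) *
      (b0 (s - a) * (a - t) ^ (-(1 / 4) : ℝ) + b0 (-s - a) * (a + t) ^ (-(1 / 4) : ℝ)) :=
    ((hI1.mul_const _).add (hI2.mul_const _)).const_mul _
  calc |oddThetaArchLayer a t| = ‖∫ s, oddThetaTail a s * weilArchDensity |t - s|‖ :=
        (Real.norm_eq_abs _).symm
    _ ≤ ∫ s, 2544 * rexp (a / 2) *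
          (b0 (s - a) * (a - t) ^ (-(1 / 4) : ℝ) + b0 (-s - a) * (a + t) ^ (-(1 / 4) : ℝ)) :=
        norm_integral_le_of_norm_le hmaj (Eventually.of_forall key)
    _ = _ := by
        rw [integral_const_mul, integral_add (hI1.mul_const _) (hI2.mul_const _),
          integral_mul_const, integral_mul_const]
        ring

/-- `u^{-1/4} ∈ L²` of the window when `u > 0` on it and `u^{-1/2}` is integrable on it. [folklore] -/
private theorem memLp_rpow_neg_quarter {a : ℝ} {u : ℝ → ℝ} (hu : Continuous u)
    (hpos : ∀ t ∈ Ioo (-a) a, 0 < u t)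
    (hint : IntegrableOn (fun t => u t ^ (-(1 / 2) : ℝ)) (Ioo (-a) a)) :
    MemLp (fun t => u t ^ (-(1 / 4) : ℝ)) 2 (volume.restrict (Ioo (-a) a)) := by
  refine (memLp_two_iff_integrable_sq (hu.measurable.pow_const _).aestronglyMeasurable).2
    (hint.congr ?_)
  filter_upwards [ae_restrict_mem measurableSet_Ioo] with t ht
  rw [← Real.rpow_two, ← Real.rpow_mul (hpos t ht).le]
  norm_num

/-! ## The window image is square-integrable on the window -/

/-- **Stub `imageMemLp`**: for `a > 0`, `𝟙_{(−a,a)} · T_a ∈ L²(ℝ)`, where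
`T_a = oddThetaImage a = 2ϖ_a sinh(t/2) + P_a + A_a` is the window image of the odd theta
vector (bounded polar and prime parts, logarithmically — here `O((a ∓ t)^{−1/4})` — singular
archimedean layer). [folklore] -/
theorem stub_imageMemLp :
    ∀ a : ℝ, 0 < a → MemLp (fun t => (Ioo (-a) a).indicator (oddThetaImage a) t) 2 volume := by
  intro a ha
  rw [show (fun t => (Ioo (-a) a).indicator (oddThetaImage a) t) = (Ioo (-a) a).indicator
    (oddThetaImage a) from rfl, memLp_indicator_iff_restrict measurableSet_Ioo]
  show MemLp (fun t => 2 * oddThetaPolarWeight a * Real.sinh (t / 2) + oddThetaPrimeLayer a t +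
    oddThetaArchLayer a t) 2 (volume.restrict (Ioo (-a) a))
  haveI : IsFiniteMeasure (volume.restrict (Ioo (-a) a)) :=
    isFiniteMeasure_restrict.2 measure_Ioo_lt_top.ne
  obtain ⟨K₁, K₂, hA⟩ := exists_abs_oddThetaArchLayer_le a
  obtain ⟨CP, hCP⟩ : ∃ CP : ℝ, ∀ t, |t| ≤ a → |oddThetaPrimeLayer a t| ≤ CP :=
    ⟨_, fun t ht => abs_oddThetaPrimeLayer_le a ht⟩
  have h1 : IntegrableOn (fun t => (a - t) ^ (-(1 / 2) : ℝ)) (Ioo (-a) a) := by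
    have h := (intervalIntegral.intervalIntegrable_rpow' (a := 0) (b := 2 * a)
      (by norm_num : (-1 : ℝ) < -(1 / 2))).comp_sub_left a
    rw [sub_zero, show a - 2 * a = -a by ring] at h
    exact (intervalIntegrable_iff_integrableOn_Ioo_of_le (by linarith)).1 h.symm
  have h2 : IntegrableOn (fun t => (a + t) ^ (-(1 / 2) : ℝ)) (Ioo (-a) a) := by
    have h := (intervalIntegral.intervalIntegrable_rpow' (a := 0) (b := 2 * a)
      (by norm_num : (-1 : ℝ) < -(1 / 2))).comp_add_left a
    rw [zero_sub, show 2 * a - a = a by ring] at h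
    exact (intervalIntegrable_iff_integrableOn_Ioo_of_le (by linarith)).1 h
  have hr1 : MemLp (fun t => (a - t) ^ (-(1 / 4) : ℝ)) 2 (volume.restrict (Ioo (-a) a)) :=
    memLp_rpow_neg_quarter (u := fun t => a - t) (by fun_prop)
      (fun t ht => show 0 < a - t from sub_pos.2 ht.2) h1
  have hr2 : MemLp (fun t => (a + t) ^ (-(1 / 4) : ℝ)) 2 (volume.restrict (Ioo (-a) a)) :=
    memLp_rpow_neg_quarter (u := fun t => a + t) (by fun_prop)
      (fun t ht => show 0 < a + t from by linarith [ht.1]) h2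
  have hc : MemLp (fun _ : ℝ => 2 * |oddThetaPolarWeight a| * Real.sinh (a / 2) + CP) 2
      (volume.restrict (Ioo (-a) a)) := memLp_const _
  have hG := (hc.add (hr1.const_mul K₁)).add (hr2.const_mul K₂)
  have hmeas : Measurable fun t => 2 * oddThetaPolarWeight a * Real.sinh (t / 2) +
      oddThetaPrimeLayer a t + oddThetaArchLayer a t :=
    (((Real.continuous_sinh.comp (continuous_id.div_const 2)).measurable.const_mul _).add
      (measurable_oddThetaPrimeLayer a)).add (measurable_oddThetaArchLayer a)
  refine hG.mono' hmeas.aestronglyMeasurable ?_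
  filter_upwards [ae_restrict_mem measurableSet_Ioo] with t ht
  have hs : |Real.sinh (t / 2)| ≤ Real.sinh (a / 2) := by
    rw [Real.abs_sinh, abs_div, abs_two]
    exact Real.sinh_le_sinh.2 (by linarith [abs_lt.2 ⟨ht.1, ht.2⟩])
  have hS : |2 * oddThetaPolarWeight a * Real.sinh (t / 2)| ≤
      2 * |oddThetaPolarWeight a| * Real.sinh (a / 2) := by
    rw [abs_mul, abs_mul, abs_two]
    exact mul_le_mul_of_nonneg_left hs (by positivity)
  have hP := hCP t (abs_le.2 ⟨ht.1.le, ht.2.le⟩)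
  rw [Real.norm_eq_abs]
  simp only [Pi.add_apply]
  linarith [abs_add_three (2 * oddThetaPolarWeight a * Real.sinh (t / 2)) (oddThetaPrimeLayer a t)
    (oddThetaArchLayer a t), hA t ht]

end Summit.RiemannHypothesis.RiemannHypothesis.Theorems.OddBartaFloor

end
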